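import Mathlib
import HarnessLib
import Summits.Langlands.Langlands.Theses.QuarterDeficit1951
import Literature.NumberTheory.Automorphic.HyperbolicLaplaceSpectrum

/-!
# Sketch — first lemmas of three crux ideas on `QuarterFingerprintDeficit` (stmt-Langlands-15897)

Idea A `christoffel-hecke-census`  : `HeckePrimePowerRecursion`, `SmoothHeckeEigen`, `christoffel_bound`
Idea B `quasimode-deflation-census`: `deflation_bound`
Idea C `hejhal-exclusion-scan`     : `FourierBesselAtInfinity`, `exclusion_principle`
Only statements are load-bearing here (crux-ideate stage: no skeleton); the two abstract
inequalities are proved because they are one-liners.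
-/

namespace Summit.Langlands.Langlands.Cruxes.QuarterFingerprintDeficit.Sketch

open scoped BigOperators ComplexConjugate

/-- Automorphy with nebentypus `χ(d)` on `Γ₀(1951)`, exactly as inlined in the crux. -/
def IsAutomorphicChi (χ : DirichletCharacter ℂ 1951) (u : UpperHalfPlane → ℂ) : Prop :=
  ∀ γ : Matrix.SpecialLinearGroup (Fin 2) ℤ, γ ∈ CongruenceSubgroup.Gamma0 1951 →
    ∀ z : UpperHalfPlane, u (γ • z) = χ ((γ 1 1 : ℤ) : ZMod 1951) * u z

/-- The classical Hecke operator `T_n` with nebentypus in the unitary normalisation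
(BLS20, §1.1): `(T_n u)(z) = n^{-1/2} Σ_{ad=n} χ(a) Σ_{b mod d} u((az+b)/d)`.
For `n = p` prime (`p ∤ 1951`) this is literally the crux's `Tp χ p u z`. -/
noncomputable def Tn (χ : DirichletCharacter ℂ 1951) (n : ℕ) (u : UpperHalfPlane → ℂ)
    (z : UpperHalfPlane) : ℂ :=
  ((Real.sqrt n : ℝ) : ℂ)⁻¹ * ∑ a ∈ n.divisors, χ (a : ZMod 1951) *
    ∑ b ∈ Finset.range (n / a),
      u (UpperHalfPlane.ofComplex (((a : ℂ) * (z : ℂ) + (b : ℂ)) / ((n / a : ℕ) : ℂ)))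

/-- The six fingerprint primes of the crux. -/
def P₀ : Finset ℕ := {2, 3, 5, 7, 11, 13}

/-- Idea A, first lemma (M-sized, classical; Atkin–Lehner/Miyake for Maass forms with character):
the prime-power Hecke recursion `T_p T_{p^k} = T_{p^{k+1}} + χ(p) T_{p^{k-1}}` on
`χ`-automorphic functions. -/
def HeckePrimePowerRecursion : Prop :=
  ∀ (χ : DirichletCharacter ℂ 1951) (u : UpperHalfPlane → ℂ), IsAutomorphicChi χ u →
    ∀ p : ℕ, p.Prime → ¬ (p ∣ 1951) → ∀ k : ℕ, 1 ≤ k → ∀ z : UpperHalfPlane,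
      Tn χ p (Tn χ (p ^ k) u) z
        = Tn χ (p ^ (k + 1)) u z + χ (p : ZMod 1951) * Tn χ (p ^ (k - 1)) u z

/-- Idea A, consequence used by the line: a joint `T_p`-eigenfunction for `p ≤ 13` is a
`T_n`-eigenfunction for every 13-smooth `n`, with eigenvalue the Hecke polynomial in the `μ_p`
(so its eigenvalue vector on the 13-smooth dictionary is DETERMINED by the fingerprint data). -/
def SmoothHeckeEigen : Prop :=
  ∀ (χ : DirichletCharacter ℂ 1951) (u : UpperHalfPlane → ℂ), IsAutomorphicChi χ u →
    (∀ p ∈ P₀, ∃ μ : ℂ, ∀ z, Tn χ p u z = μ * u z) →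
    ∀ n : ℕ, n ≠ 0 → (∀ q : ℕ, q.Prime → q ∣ n → q ∈ P₀) →
      ∃ ν : ℂ, ∀ z, Tn χ n u z = ν * u z

/-- Idea A, the positivity ("Christoffel") bound that turns a dual vector into a deficit
certificate: one nonnegative term of the weighted Hecke Gram form is bounded by the whole form.
Here `w j = h(r_j) ≥ 0` are the test-function weights of an orthonormal Hecke–Maass eigenbasis,
`v j n = a_j(n)` its eigenvalues on the dictionary `S`, `c` the dual vector. -/
theorem christoffel_bound {ι : Type*} (S : Finset ℕ) (w : ι → ℝ) (hw : ∀ j, 0 ≤ w j)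
    (v : ι → ℕ → ℂ) (c : ℕ → ℂ) (j₀ : ι)
    (hs : Summable fun j => w j * ‖∑ n ∈ S, conj (c n) * v j n‖ ^ 2) :
    w j₀ * ‖∑ n ∈ S, conj (c n) * v j₀ n‖ ^ 2
      ≤ ∑' j, w j * ‖∑ n ∈ S, conj (c n) * v j n‖ ^ 2 := by
  classical
  exact hs.le_tsum j₀ (fun j _ => mul_nonneg (hw j) (by positivity))

/-- Idea B, the deflation inequality: certified forms `J` with weight lower bounds `ℓ` leave at
most `T − Σ ℓ` of the total trace `T = Σ' w` for any other form. -/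
theorem deflation_bound {ι : Type*} (w : ι → ℝ) (hw : ∀ j, 0 ≤ w j) (hs : Summable w)
    (J : Finset ι) (ℓ : ι → ℝ) (hℓ : ∀ j ∈ J, ℓ j ≤ w j) (j₁ : ι) (hj₁ : j₁ ∉ J) :
    w j₁ ≤ ∑' j, w j - ∑ j ∈ J, ℓ j := by
  classical
  have h1 : ∑ j ∈ insert j₁ J, w j ≤ ∑' j, w j :=
    hs.sum_le_tsum (insert j₁ J) (fun j _ => hw j)
  rw [Finset.sum_insert hj₁] at h1
  have h2 : ∑ j ∈ J, ℓ j ≤ ∑ j ∈ J, w j := Finset.sum_le_sum hℓ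
  linarith

/-- `K_{ir}(y)` for `y > 0`, `r ∈ ℝ`, through its integral representation
`K_{ir}(y) = ∫_0^∞ e^{-y cosh t} cos(r t) dt` (no Bessel functions in Mathlib). -/
noncomputable def besselKi (r y : ℝ) : ℝ :=
  ∫ t in Set.Ioi (0 : ℝ), Real.exp (-y * Real.cosh t) * Real.cos (r * t)

/-- Idea C, first lemma (M-sized, classical; Iwaniec 2002 §3 / Hejhal): a bounded `χ`-automorphic
`C²` solution of `Δu + (1/4 + r²)u = 0` with vanishing constant term at `∞` has a Fourier–Bessel
expansion at the cusp `∞` with polynomially bounded coefficients (this is what makes the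
truncated automorphy system an ε-quasi-kernel vector, the input of the exclusion scan). -/
def FourierBesselAtInfinity : Prop :=
  ∀ (χ : DirichletCharacter ℂ 1951) (u : UpperHalfPlane → ℂ) (r : ℝ),
    Literature.NumberTheory.Automorphic.IsC2 u →
    (∀ z, Literature.NumberTheory.Automorphic.hypLaplacian u z + (((1 / 4 + r ^ 2 : ℝ)) : ℂ) * u z = 0) →
    IsAutomorphicChi χ u → (∃ C : ℝ, ∀ z, ‖u z‖ ≤ C) →
    (∀ y : ℝ, 0 < y → ∫ x in (0 : ℝ)..1, u (UpperHalfPlane.ofComplex (x + y * Complex.I)) = 0) →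
    ∃ a : ℤ → ℂ, a 0 = 0 ∧ (∃ C k : ℝ, ∀ n : ℤ, ‖a n‖ ≤ C * (1 + |(n : ℝ)|) ^ k) ∧
      ∀ x y : ℝ, 0 < y →
        HasSum (fun n : ℤ => a n * ((Real.sqrt y * besselKi r (2 * Real.pi * |(n : ℝ)| * y) : ℝ) : ℂ)
            * Complex.exp (2 * Real.pi * Complex.I * (n : ℂ) * (x : ℂ)))
          (u (UpperHalfPlane.ofComplex ((x : ℂ) + (y : ℂ) * Complex.I)))

/-- Idea C, the exclusion principle behind the scan (finite-dimensional, elementary): if every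
unit vector is moved by at least `ε` by the (truncated automorphy) matrix `V`, then no nonzero
`ε`-quasi-kernel vector exists — contrapositive of "a true window form gives
`‖V a‖ ≤ ε_trunc ‖a‖`". -/
theorem exclusion_principle {m k : ℕ} (V : Matrix (Fin m) (Fin k) ℂ) (ε : ℝ)
    (hσ : ∀ a : Fin k → ℂ, ε * ‖(WithLp.equiv 2 (Fin k → ℂ)).symm a‖
      < ‖(WithLp.equiv 2 (Fin m → ℂ)).symm (V.mulVec a)‖ ∨ a = 0) :
    ¬ ∃ a : Fin k → ℂ, a ≠ 0 ∧
      ‖(WithLp.equiv 2 (Fin m → ℂ)).symm (V.mulVec a)‖ ≤ ε * ‖(WithLp.equiv 2 (Fin k → ℂ)).symm a‖ := by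
  rintro ⟨a, ha, hle⟩
  rcases hσ a with h | h
  · exact absurd hle (not_le.mpr h)
  · exact ha h

end Summit.Langlands.Langlands.Cruxes.QuarterFingerprintDeficit.Sketch
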